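import Summits.QuantumFields.BalabanUV.Beta.GAN24.DressedLegSawtoothBlockL1

/-!
# `BalabanUV.Beta.GAN24.DressedLegBlockL1Envelope` — binder row G-an2-4 ∕ (CONV-C), W-slot, the (α-0) parity re-cut, located crux (Q-L-k₀)
# (RULING R-gan24p1-g36-1 (4)(B)): **THE DRESSED COMPOSITE LEG FAMILIES ARE `T^B`-SIZED IN BLOCK-ℓ¹, UNIFORMLY IN THE PAIR OF LEVELS** —
# `Σ_{t ∈ box (Lc^{k+1})} |legChain (respStepBmSeq ρ Lc) m k μ z κ (Lc^{k+1}•c + t)| ≤ K·(k+1)·(Lc^{k+1})⁻¹·e^{−κ₀‖c − z‖∞}` (OWNER `b2b-balaban-gan24-p1`, gen 36; part 2 of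
# `GAN24/DressedLegSawtoothBlockL1`)

NOT IN PRINT; OUR BOOKKEEPING ([folklore] triangle inequalities over leaf-03 g41's decomposition, leaf-12's (N1) letter and part 1's sawtooth count BY NAME; 0 `def`, 0 cited
facts, 0 `def … : Prop`, 0 sorry).  HONEST FRAMING (cell contract, verbatim): «discharging `BetaPertH` makes Bałaban's UV stability UNCONDITIONAL — a real constructive-QFT
result; it is NOT the continuum limit and NOT the Clay problem.»  HONEST DEPENDENCY (verbatim): «continuum YM on T⁴ ⇐ BetaPertH ∧ nine spine estimates (0/9 proved); BetaPertH ⇐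
(D1) ∧ (D4) ∧ CAP+tail; G-an2-4 gates asym, D1 and NE2/3/4.»

WHAT (`d = 3`, `[NeZero Lc]`, in-block root).  **`exists_legChain_blockL1_envelope`** — leaf-12's rate `κ₀ > 0` and ONE `K ≥ 0` with the displayed block-ℓ¹ law for ALL
`m k μ z κ c`: the kernel entry is the dressed chain on the point datum (`legAct_single`), split by `legAct_legChain_respStepBm` into `Π^ρ_bm T^B` (pointwise, as in leaf-01 g57's
`DressedLegEnvelope.exists_legChain_envelope`; the envelope is constant on the source block) plus `dz Ψ` (part 1's `sum_box_abs_dz_Psi_single_le`: `T^B`-sized per unit volume,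
`k` levels).  Compare the SUP law `exists_legChain_envelope` (`K·(Lc^{4(k+1)})⁻¹` per point = `K·(Lc^{k+1})^{3}` per block): ONE POWER OF THE RELATIVE BLOCKING MORE than here.
THIS is the kernel-leg hypothesis `hρ` of the (H1♮) core in block-ℓ¹ currency (`ThreeLegDoubleFreezeBlockL1.abs_threeLeg_blockSum_le_of_blockL1`) for the row legs
`legChain (rowM (coDressKBmAt ρ Lc K̃_j))` = `±legChain (respStepBmSeq ρ Lc)` (`RespStepBmDecompPsi.legChain_rowM_coDressKBmAt_KStepUnit`).  Asserts NOTHING about Bałaban's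
tables; NOT (H1♮); NEVER «G-an2-4 closed» as (CONV-C); NOT D1, NOT `BetaPertH`, NOT continuum, NOT Clay.  2026-08-23; no existing file touched.
-/

noncomputable section

open Finset
open scoped BigOperators
open Literature.MathematicalPhysics.QuantumFieldTheory
open Literature.MathematicalPhysics.QuantumFieldTheory.LatticeForm (quo)
open Literature.MathematicalPhysics.QuantumFieldTheory.Balaban1983to89
open Literature.MathematicalPhysics.QuantumFieldTheory.Balaban1983to89.Beta
open B4ContourShift (supNorm)
open AffineAveraging (Form0 Form1 Site box toSite unitVec dz)
open AveragingContours (blk grad_eq_dz)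
open BalabanCompositeJets (respStep)
open KKTFluctuationEnergy (quo_zsmul_add_toSite)
open Summit.QuantumFields.BalabanUV.Beta.AxialProjectorBlockMean (bmGaugeAt axProjBmAt)
open Summit.QuantumFields.BalabanUV.Beta.GAN24.Push4Iter (legChain)
open Summit.QuantumFields.BalabanUV.Beta.GAN24.RespStepBmDecompLegs (legAct)
open Summit.QuantumFields.BalabanUV.Beta.GAN24.RespStepBmDecompExact (respStepBmSeq)
open Summit.QuantumFields.BalabanUV.Beta.GAN24.RespStepBmDecompPsi (Psi legAct_legChain_respStepBm)
open Summit.QuantumFields.BalabanUV.Beta.GAN24.RespStepDecay (exists_respStep_decay_and_grad)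
open Summit.QuantumFields.BalabanUV.Beta.GAN24.UndressedResponseUnits (inv_cast_pow_pow)
open Summit.QuantumFields.BalabanUV.Beta.GAN24.DressedLegEnvelope (bmGaugeAt_respStep_envelope blk_pow_blk_pow legAct_single summable_single_and_le)
open Summit.QuantumFields.BalabanUV.Beta.GAN24.StaircaseFaces (env_add_unitVec_le)
open Summit.QuantumFields.BalabanUV.Beta.GAN24.TransversalZeroMode (card_box_succ)
open Summit.QuantumFields.BalabanUV.Beta.GAN24.DressedLegSawtoothBlockL1 (sum_box_abs_dz_Psi_single_le)

namespace Summit.QuantumFields.BalabanUV.Beta.GAN24.DressedLegBlockL1Envelope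

section Four

variable {Lc : ℕ} [NeZero Lc]

/-- NOT IN PRINT; OUR BOOKKEEPING.  **THE DRESSED COMPOSITE LEG FAMILIES ARE `T^B`-SIZED IN BLOCK-ℓ¹, UNIFORMLY IN THE PAIR OF LEVELS** (`d = 3`, `[NeZero Lc]`,
in-block root `ρ = toSite rr`; leaf-12's rate `κ₀ > 0` and ONE `K ≥ 0`): for ALL `m k μ z κ c`,
`Σ_{t ∈ box (Lc^{k+1})} |legChain (respStepBmSeq ρ Lc) m k μ z κ (Lc^{k+1}•c + t)| ≤ K·(k+1)·(Lc^{k+1})⁻¹·e^{−κ₀‖c − z‖∞}` — the kernel entry is the dressed chain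
acting on the point datum (`legAct_single`); leaf-03's decomposition `T^E = Π^ρ_bm T^B + dz Ψ` (`legAct_legChain_respStepBm`); the `Π^ρ_bm T^B` part pointwise as in leaf-01's
`DressedLegEnvelope.exists_legChain_envelope` (envelope constant on the source block), the sawtooth by §3.  Compare the SUP law `exists_legChain_envelope`: `K·(Lc^{4(k+1)})⁻¹` per
POINT, i.e. `K·(Lc^{k+1})^{d}` per block — ONE POWER OF THE RELATIVE BLOCKING MORE than here.  THIS is the kernel-leg hypothesis `hρ` of the (H1♮) core in block-ℓ¹ currency
(RULING R-gan24p1-g36-1 (4); `ThreeLegDoubleFreezeBlockL1.abs_threeLeg_blockSum_le_of_blockL1`) for the row legs `legChain (rowM (coDressKBmAt ρ Lc K̃_j))` = `±legChain (respStepBmSeq ρ Lc)`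
(`RespStepBmDecompPsi.legChain_rowM_coDressKBmAt_KStepUnit`). -/
theorem exists_legChain_blockL1_envelope :
    ∃ κ₀ K : ℝ, 0 < κ₀ ∧ 0 ≤ K ∧ ∀ (rr : Fin (3 + 1) → ℕ), rr ∈ box (3 + 1) Lc →
      ∀ (m k : ℕ) (μ : Fin (3 + 1)) (z : Site (3 + 1)) (κ : Fin (3 + 1)) (c : Site (3 + 1)),
        ∑ t ∈ box (3 + 1) (Lc ^ (k + 1)),
            |legChain (respStepBmSeq (d := 3) (toSite rr) Lc) m k μ z κ (((Lc ^ (k + 1) : ℕ) : ℤ) • c + toSite t)|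
          ≤ K * ((k : ℝ) + 1) * ((Lc : ℝ) ^ (k + 1))⁻¹ * Real.exp (-(κ₀ * supNorm (c - z))) := by
  classical
  obtain ⟨κ₀, C, C', hκ₀, hC, -, hN1', -⟩ := exists_respStep_decay_and_grad (Lc := Lc)
  have hN1 : ∀ (m k : ℕ) (μ : Fin (3 + 1)) (z : Site (3 + 1)) (l'' : Fin (3 + 1)) (w' : Site (3 + 1)),
      |respStep (d := 3) (Lc ^ m) (Lc ^ (m + k + 1)) μ z l'' w'| ≤
        C * ((Lc : ℝ) ^ (5 * (k + 1)))⁻¹ * Real.exp (-(κ₀ * supNorm (quo (Lc ^ (k + 1)) w' - z))) := by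
    intro m k μ z l'' w'
    have h := hN1' m k μ z l'' w'
    rwa [inv_cast_pow_pow] at h
  set W : ℝ := Real.exp κ₀ + 1 with hW
  have hW0 : 0 ≤ W := by positivity
  have hL0 : (0 : ℝ) < Lc := by exact_mod_cast Nat.pos_of_ne_zero (NeZero.ne Lc)
  have hne : (Lc : ℝ) ≠ 0 := hL0.ne'
  refine ⟨κ₀, (C + 8 * (Lc : ℝ) * C * W) + 16 * (Lc : ℝ) * Real.exp κ₀ * C, hκ₀, by positivity, ?_⟩
  intro rr hrr m k μ z κ c
  haveI : NeZero (Lc ^ (k + 1)) := ⟨pow_ne_zero _ (NeZero.ne Lc)⟩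
  obtain ⟨hsum, -⟩ := summable_single_and_le (d := 3) μ z
  set E : ℝ := Real.exp (-(κ₀ * supNorm (c - z))) with hE
  have hE0 : 0 ≤ E := (Real.exp_pos _).le
  -- the label of every point of the source block
  have hlab : ∀ t ∈ box (3 + 1) (Lc ^ (k + 1)), quo (Lc ^ (k + 1)) (((Lc ^ (k + 1) : ℕ) : ℤ) • c + toSite t) = c :=
    fun t ht => quo_zsmul_add_toSite c ht
  -- (a) pointwise: the projector part at any fine point `u`
  have hcol : ∀ (κ' : Fin (3 + 1)) (w : Site (3 + 1)),
      |legAct (respStep (d := 3) (Lc ^ m) (Lc ^ (m + k + 1))) (fun μ' y => if μ' = μ then (if y = z then (1 : ℝ) else 0) else 0) κ' w|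
        ≤ C * ((Lc : ℝ) ^ (5 * (k + 1)))⁻¹ * Real.exp (-(κ₀ * supNorm (quo (Lc ^ (k + 1)) w - z))) := by
    intro κ' w
    rw [legAct_single]
    exact hN1 m k μ z κ' w
  have hgauge : ∀ w : Site (3 + 1),
      |bmGaugeAt (toSite rr) (legAct (respStep (d := 3) (Lc ^ m) (Lc ^ (m + k + 1)))
          (fun μ' y => if μ' = μ then (if y = z then (1 : ℝ) else 0) else 0)) Lc w|
        ≤ 8 * (Lc : ℝ) * C * ((Lc : ℝ) ^ (5 * (k + 1)))⁻¹ * Real.exp (-(κ₀ * supNorm (quo (Lc ^ (k + 1)) w - z))) := by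
    intro w
    have h := bmGaugeAt_respStep_envelope (Lc := Lc) hN1 hrr m k (m + k + 1) rfl μ z w
    have hlab' : blk (Lc ^ k) (blk Lc w) = quo (Lc ^ (k + 1)) w := by
      have h1 := blk_pow_blk_pow Lc k 1 w
      rw [pow_one, show 1 + k = k + 1 by ring] at h1
      rw [h1]; rfl
    rwa [hlab'] at h
  have hproj : ∀ u : Site (3 + 1), |axProjBmAt (toSite rr) Lc (legAct (respStep (d := 3) (Lc ^ m) (Lc ^ (m + k + 1)))
        (fun μ' y => if μ' = μ then (if y = z then (1 : ℝ) else 0) else 0)) κ u|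
      ≤ (C + 8 * (Lc : ℝ) * C * W) * ((Lc : ℝ) ^ (5 * (k + 1)))⁻¹ * Real.exp (-(κ₀ * supNorm (quo (Lc ^ (k + 1)) u - z))) := by
    intro u
    unfold axProjBmAt
    rw [Pi.sub_apply, Pi.sub_apply, grad_eq_dz]
    simp only [dz]
    have h0 := hcol κ u
    have h1 := hgauge (u + unitVec κ)
    have h2 := hgauge u
    have h3 := env_add_unitVec_le (N := Lc ^ (k + 1)) hκ₀.le z u κ
    have hA : 0 ≤ 8 * (Lc : ℝ) * C * ((Lc : ℝ) ^ (5 * (k + 1)))⁻¹ := by positivity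
    have h1' := h1.trans (mul_le_mul_of_nonneg_left h3 hA)
    calc _ ≤ |legAct (respStep (d := 3) (Lc ^ m) (Lc ^ (m + k + 1)))
              (fun μ' y => if μ' = μ then (if y = z then (1 : ℝ) else 0) else 0) κ u|
            + |bmGaugeAt (toSite rr) (legAct (respStep (d := 3) (Lc ^ m) (Lc ^ (m + k + 1)))
                (fun μ' y => if μ' = μ then (if y = z then (1 : ℝ) else 0) else 0)) Lc (u + unitVec κ)
              - bmGaugeAt (toSite rr) (legAct (respStep (d := 3) (Lc ^ m) (Lc ^ (m + k + 1)))
                (fun μ' y => if μ' = μ then (if y = z then (1 : ℝ) else 0) else 0)) Lc u| := abs_sub _ _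
      _ ≤ C * ((Lc : ℝ) ^ (5 * (k + 1)))⁻¹ * Real.exp (-(κ₀ * supNorm (quo (Lc ^ (k + 1)) u - z)))
            + (8 * (Lc : ℝ) * C * ((Lc : ℝ) ^ (5 * (k + 1)))⁻¹ *
                (Real.exp κ₀ * Real.exp (-(κ₀ * supNorm (quo (Lc ^ (k + 1)) u - z))))
              + 8 * (Lc : ℝ) * C * ((Lc : ℝ) ^ (5 * (k + 1)))⁻¹ * Real.exp (-(κ₀ * supNorm (quo (Lc ^ (k + 1)) u - z)))) :=
          add_le_add h0 ((abs_sub _ _).trans (add_le_add h1' h2))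
      _ = _ := by rw [hW]; ring
  -- (b) the entry, decomposed, pointwise on the block
  have hpt : ∀ t ∈ box (3 + 1) (Lc ^ (k + 1)),
      |legChain (respStepBmSeq (d := 3) (toSite rr) Lc) m k μ z κ (((Lc ^ (k + 1) : ℕ) : ℤ) • c + toSite t)|
        ≤ (C + 8 * (Lc : ℝ) * C * W) * ((Lc : ℝ) ^ (5 * (k + 1)))⁻¹ * E
          + |dz (Psi (toSite rr) Lc m k (fun μ' y => if μ' = μ then (if y = z then (1 : ℝ) else 0) else 0)) κ
              (((Lc ^ (k + 1) : ℕ) : ℤ) • c + toSite t)| := by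
    intro t ht
    rw [← legAct_single (legChain (respStepBmSeq (d := 3) (toSite rr) Lc) m k) μ z κ _,
      legAct_legChain_respStepBm hrr m k hsum, Pi.add_apply, Pi.add_apply]
    have h := hproj (((Lc ^ (k + 1) : ℕ) : ℤ) • c + toSite t)
    rw [hlab t ht] at h
    exact (abs_add_le _ _).trans (add_le_add h le_rfl)
  refine (Finset.sum_le_sum hpt).trans ?_
  rw [Finset.sum_add_distrib, Finset.sum_const, card_box_succ, nsmul_eq_mul]
  have hsaw := sum_box_abs_dz_Psi_single_le (Lc := Lc) hκ₀.le hC hN1 hrr m k μ z κ c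
  rw [← hE] at hsaw
  -- the projector part: `(Lc^{k+1})^4 · (Lc^{5(k+1)})⁻¹ = (Lc^{k+1})⁻¹`
  push_cast
  have hN0 : ((Lc : ℝ) ^ (k + 1)) ^ 4 ≠ 0 := pow_ne_zero _ (pow_ne_zero _ hne)
  have e5 : ((Lc : ℝ) ^ (5 * (k + 1)))⁻¹ = (((Lc : ℝ) ^ (k + 1)) ^ 4)⁻¹ * ((Lc : ℝ) ^ (k + 1))⁻¹ := by
    rw [← mul_inv, ← pow_mul, ← pow_add]; congr 2; ring
  have hprojsum : ((Lc : ℝ) ^ (k + 1)) ^ 4 * ((C + 8 * (Lc : ℝ) * C * W) * ((Lc : ℝ) ^ (5 * (k + 1)))⁻¹ * E)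
      = (C + 8 * (Lc : ℝ) * C * W) * ((Lc : ℝ) ^ (k + 1))⁻¹ * E := by
    rw [e5]
    calc ((Lc : ℝ) ^ (k + 1)) ^ 4 * ((C + 8 * (Lc : ℝ) * C * W) * ((((Lc : ℝ) ^ (k + 1)) ^ 4)⁻¹ * ((Lc : ℝ) ^ (k + 1))⁻¹) * E)
        = (C + 8 * (Lc : ℝ) * C * W) * ((Lc : ℝ) ^ (k + 1))⁻¹ * E * (((Lc : ℝ) ^ (k + 1)) ^ 4 * (((Lc : ℝ) ^ (k + 1)) ^ 4)⁻¹) := by ring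
      _ = _ := by rw [mul_inv_cancel₀ hN0, mul_one]
  rw [hprojsum]
  -- assemble: `A·x + 16kLc e^{κ₀} C·x ≤ K·(k+1)·x` with `K = A + 16 Lc e^{κ₀} C`
  have hx0 : 0 ≤ ((Lc : ℝ) ^ (k + 1))⁻¹ * E := by positivity
  have hk0 : (0 : ℝ) ≤ k := Nat.cast_nonneg k
  have hA0 : 0 ≤ C + 8 * (Lc : ℝ) * C * W := by positivity
  have hB0 : 0 ≤ 16 * (Lc : ℝ) * Real.exp κ₀ * C := by positivity
  calc (C + 8 * (Lc : ℝ) * C * W) * ((Lc : ℝ) ^ (k + 1))⁻¹ * E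
        + ∑ t ∈ box (3 + 1) (Lc ^ (k + 1)),
            |dz (Psi (toSite rr) Lc m k (fun μ' y => if μ' = μ then (if y = z then (1 : ℝ) else 0) else 0)) κ
                (((Lc ^ (k + 1) : ℕ) : ℤ) • c + toSite t)|
      ≤ (C + 8 * (Lc : ℝ) * C * W) * ((Lc : ℝ) ^ (k + 1))⁻¹ * E
          + 16 * (k : ℝ) * (Lc : ℝ) * Real.exp κ₀ * C * ((Lc : ℝ) ^ (k + 1))⁻¹ * E := add_le_add le_rfl hsaw
    _ = ((C + 8 * (Lc : ℝ) * C * W) + (k : ℝ) * (16 * (Lc : ℝ) * Real.exp κ₀ * C)) * (((Lc : ℝ) ^ (k + 1))⁻¹ * E) := by ring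
    _ ≤ (((C + 8 * (Lc : ℝ) * C * W) + 16 * (Lc : ℝ) * Real.exp κ₀ * C) * ((k : ℝ) + 1)) * (((Lc : ℝ) ^ (k + 1))⁻¹ * E) := by
        apply mul_le_mul_of_nonneg_right _ hx0
        nlinarith [mul_nonneg hA0 hk0, mul_nonneg hB0 hk0, hA0, hB0]
    _ = _ := by ring

end Four

end Summit.QuantumFields.BalabanUV.Beta.GAN24.DressedLegBlockL1Envelope

end
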